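import Summits.CriticalPhenomena.Ising3D.Control2DTermwise
import Mathlib.Analysis.SpecialFunctions.Pow.Real
import Mathlib.Tactic.Linarith
import Mathlib.Tactic.Positivity
import Mathlib.Tactic.Ring
import Mathlib.Tactic.FieldSimp
import HarnessLib

/-!
# The 2D global block in the typed block shape `(z z̄)^τ K(z,z̄)`, and its diagonal inequalities
(cell `pub-ising3x`, seat controls-1 gen 14; KERNEL PATH for the 2D γ (derivative-functional)
certificates, step 1a — CONTROL-ONLY)

HONEST FRAMING: lottery ticket; floor = tightest certified 3D Ising CFT bounds; no exact-solution
claim without a proof. CONTROL-ONLY (`d = 2`); nothing numerical is asserted here.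

Every typed soundness theorem of the 2D control (`Control2DBootstrap`, `Control2DOpeTwoSided`,
`Control2DOpeEpsTwoSided`) is proved for EVALUATION-CONTINUOUS functionals (finite point functionals),
while the certificates of record since RB-1 use the DERIVATIVE functional at `z = z̄ = 1/2`. The boot-1
chain (`TaylorGerm` → `TaylorFunctional` → `BlockTaylorGerm(Families)`) proves termwise action of such
Taylor functionals for any family of functions of BLOCK SHAPE `g(z,z̄) = (z z̄)^τ K(z,z̄)`, `τ ≥ 0`, `K` a
double power series on the unit bidisk (`IsDoublePowerSeriesOn k K`), whose block VALUES at two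
diagonal points are summable against the weights (`crossF_germ_majorant`,
`hasSummableGerms_of_blockShape`). This file supplies the 2D inputs:

* `gbCoeff Δ ℓ`, `gbSeries Δ ℓ`, `isDoublePowerSeriesOn_gbSeries`, `globalBlock_eq_shape`: for
  `ℓ ≤ Δ` the closed-form parity-symmetrised global block IS of block shape, with `τ = (Δ-ℓ)/2 = h̄`
  and the NON-NEGATIVE integer-exponent array
  `k_{mn} = [ℓ ≤ m] a_{m-ℓ}(h) a_n(h̄) + [ℓ ≤ n] a_m(h̄) a_{n-ℓ}(h)` (`a_m = chiralCoeff`,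
  `h = h̄ + ℓ`), from `k_{2h}(x) = ∑ a_m(h) x^{h+m}` (`hasSum_chiralBlock`);
* `hasSum_globalBlock_diag`, `globalBlock_diag_nonneg/_mono/_le_ratio`: on the diagonal
  `g_{Δ,ℓ}(y,y) = ∑ 2 a_m a_{m'} y^{Δ+m+m'}` is `≥ 0`, increasing in `y`, and
  `g(x,x) ≤ (x/(1-x))^{τ₀} g(1-x,1-x)` for `x ≤ 1/2`, `τ₀ ≤ Δ` (every exponent is `≥ Δ`);
* `diagConst`, `diagConst_pos`, `crossF_globalBlock_diag_le`: hence the sum-rule term at a diagonal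
  point `x ≤ 1/2` obeys `F_-[g_{Δ,ℓ}](x,x) ≤ -c · g_{Δ,ℓ}(1-x,1-x)` with
  `c = ((1-x)²)^s ((x/(1-x))^{2s} - (x/(1-x))^{τ₀}) > 0` as soon as `τ₀ > 2s` and `x < 1/2` — the
  sign fact that lets `Control2DTaylorTermwise.lean` DERIVE absolute OPE convergence on the diagonal
  from the (unconditionally convergent, `HasSum`) sum rule plus the gap hypotheses of each typed
  statement, instead of assuming it;

(The pair monomials `x^a y^b + x^b y^a` of the block's own expansion are put in block shape in
`Control2DTaylorPairs.lean`.)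

Sources: F. A. Dolan, H. Osborn, Nucl. Phys. B 678 (2004) 491, §3 (the `ε = 0` blocks);
R. Rattazzi, V. S. Rychkov, E. Tonni, A. Vichi, JHEP 12 (2008) 031, §3 (the sum rule); elementary
real analysis otherwise. Tree: `chiralCoeff`, `chiralCoeff_nonneg`, `hasSum_chiral_mul`,
`hasSum_blockPair`, `pairPow` (`Control2DTermwise`), `IsDoublePowerSeriesOn`
(`Literature/…/ConformalBootstrap3D/SigmaEpsilonSystem`),
`LegendreP.summable_abs_ordinaryHypergeometricCoefficient_mul_pow` (radius 1 of `₂F₁`).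
-/

namespace Summit.CriticalPhenomena.Ising3D.Control2D

open Set
open Literature.MathematicalPhysics.QuantumFieldTheory.ConformalBootstrap3D

/-! ### Reindexing helpers on `ℕ × ℕ` -/

/-- A family on `ℕ × ℕ` vanishing off `ℓ ≤ p.1` has the sum of its shift `(m, n) ↦ (m + ℓ, n)`.
Elementary (`Function.Injective.hasSum_iff`). [folklore] -/
theorem hasSum_of_shift_fst {f : ℕ × ℕ → ℝ} {a : ℝ} (ℓ : ℕ)
    (hf : ∀ p : ℕ × ℕ, ¬ ℓ ≤ p.1 → f p = 0)
    (h : HasSum (fun q : ℕ × ℕ => f (q.1 + ℓ, q.2)) a) : HasSum f a := by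
  have hginj : Function.Injective (fun q : ℕ × ℕ => (q.1 + ℓ, q.2)) := by
    intro q q' hq
    simp only [Prod.mk.injEq] at hq
    exact Prod.ext (by omega) hq.2
  refine (hginj.hasSum_iff (f := f) fun p hp => hf p fun hle => hp ⟨(p.1 - ℓ, p.2), ?_⟩).mp h
  simp [Nat.sub_add_cancel hle]

/-- A family on `ℕ × ℕ` vanishing off `ℓ ≤ p.2` has the sum of its shift `(m, n) ↦ (m, n + ℓ)`.
Elementary. [folklore] -/
theorem hasSum_of_shift_snd {f : ℕ × ℕ → ℝ} {a : ℝ} (ℓ : ℕ)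
    (hf : ∀ p : ℕ × ℕ, ¬ ℓ ≤ p.2 → f p = 0)
    (h : HasSum (fun q : ℕ × ℕ => f (q.1, q.2 + ℓ)) a) : HasSum f a := by
  have hginj : Function.Injective (fun q : ℕ × ℕ => (q.1, q.2 + ℓ)) := by
    intro q q' hq
    simp only [Prod.mk.injEq] at hq
    exact Prod.ext hq.1 (by omega)
  refine (hginj.hasSum_iff (f := f) fun p hp => hf p fun hle => hp ⟨(p.1, p.2 - ℓ), ?_⟩).mp h
  simp [Nat.sub_add_cancel hle]

/-- Summable version of `hasSum_of_shift_fst`. [folklore] -/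
theorem summable_of_shift_fst {f : ℕ × ℕ → ℝ} (ℓ : ℕ) (hf : ∀ p : ℕ × ℕ, ¬ ℓ ≤ p.1 → f p = 0)
    (h : Summable (fun q : ℕ × ℕ => f (q.1 + ℓ, q.2))) : Summable f :=
  (hasSum_of_shift_fst ℓ hf h.hasSum).summable

/-- Summable version of `hasSum_of_shift_snd`. [folklore] -/
theorem summable_of_shift_snd {f : ℕ × ℕ → ℝ} (ℓ : ℕ) (hf : ∀ p : ℕ × ℕ, ¬ ℓ ≤ p.2 → f p = 0)
    (h : Summable (fun q : ℕ × ℕ => f (q.1, q.2 + ℓ))) : Summable f :=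
  (hasSum_of_shift_snd ℓ hf h.hasSum).summable

/-! ### The chiral coefficients: sign and radius -/

/-- `|a_m(h)| = a_m(h)` for `h ≥ 0`. [folklore] -/
theorem abs_chiralCoeff {h : ℝ} (hh : 0 ≤ h) (m : ℕ) : |chiralCoeff h m| = chiralCoeff h m :=
  abs_of_nonneg (chiralCoeff_nonneg hh m)

/-- `∑_m |a_m(h)| r^m < ∞` for `0 ≤ r < 1`: the `₂F₁(h,h;2h;·)` series has radius `1` (Andrews–Askey–Roy
§2.1, via the tree's `LegendreP.summable_abs_ordinaryHypergeometricCoefficient_mul_pow`).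
[cite: DolanOsborn2004, §3] -/
theorem summable_abs_chiralCoeff_mul_pow (h : ℝ) {r : ℝ} (hr0 : 0 ≤ r) (hr1 : r < 1) :
    Summable fun m : ℕ => |chiralCoeff h m| * r ^ m :=
  Literature.NumberTheory.Automorphic.LegendreP.summable_abs_ordinaryHypergeometricCoefficient_mul_pow
    h h (2 * h) r hr0 hr1

/-! ### The global block in block shape -/

/-- The integer-exponent coefficient array of `K_{Δ,ℓ}`:
`k_{mn} = [ℓ ≤ m] a_{m-ℓ}(h) a_n(h̄) + [ℓ ≤ n] a_m(h̄) a_{n-ℓ}(h)`, `h = (Δ+ℓ)/2`, `h̄ = (Δ-ℓ)/2`, so that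
`g_{Δ,ℓ}(z,z̄) = (z z̄)^{h̄} ∑ k_{mn} z^m z̄^n`. [cite: DolanOsborn2004, §3] -/
noncomputable def gbCoeff (Δ : ℝ) (ℓ : ℕ) (p : ℕ × ℕ) : ℝ :=
  (if ℓ ≤ p.1 then chiralCoeff ((Δ + ℓ) / 2) (p.1 - ℓ) * chiralCoeff ((Δ - ℓ) / 2) p.2 else 0) +
    (if ℓ ≤ p.2 then chiralCoeff ((Δ - ℓ) / 2) p.1 * chiralCoeff ((Δ + ℓ) / 2) (p.2 - ℓ) else 0)

/-- The double power series `K_{Δ,ℓ}(z,z̄) = ∑ k_{mn} z^m z̄^n` (as an unconditional sum; on the unit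
bidisk it converges absolutely, `isDoublePowerSeriesOn_gbSeries`). [cite: DolanOsborn2004, §3] -/
noncomputable def gbSeries (Δ : ℝ) (ℓ : ℕ) (z zb : ℝ) : ℝ :=
  ∑' p : ℕ × ℕ, gbCoeff Δ ℓ p * z ^ p.1 * zb ^ p.2

/-- The array is non-negative for `ℓ ≤ Δ` (`h, h̄ ≥ 0`). [folklore] -/
theorem gbCoeff_nonneg {Δ : ℝ} {ℓ : ℕ} (hΔ : (ℓ : ℝ) ≤ Δ) (p : ℕ × ℕ) : 0 ≤ gbCoeff Δ ℓ p := by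
  have hℓ : (0 : ℝ) ≤ ℓ := Nat.cast_nonneg ℓ
  have hh : 0 ≤ (Δ + ℓ) / 2 := by linarith
  have hhb : 0 ≤ (Δ - ℓ) / 2 := by linarith
  unfold gbCoeff
  refine add_nonneg ?_ ?_
  · split_ifs
    · exact mul_nonneg (chiralCoeff_nonneg hh _) (chiralCoeff_nonneg hhb _)
    · exact le_rfl
  · split_ifs
    · exact mul_nonneg (chiralCoeff_nonneg hhb _) (chiralCoeff_nonneg hh _)
    · exact le_rfl

/-- **`K_{Δ,ℓ}` is a double power series on the unit bidisk** (the typed clause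
`IsDoublePowerSeriesOn`): absolute summability of `|k_{mn}| |z|^m |z̄|^n` for `|z|, |z̄| < 1` from the
radius-`1` convergence of the two `₂F₁` series (products of summable non-negative families, shifted by
`ℓ`). [cite: DolanOsborn2004, §3] -/
theorem isDoublePowerSeriesOn_gbSeries {Δ : ℝ} {ℓ : ℕ} (hΔ : (ℓ : ℝ) ≤ Δ) :
    IsDoublePowerSeriesOn (gbCoeff Δ ℓ) (gbSeries Δ ℓ) := by
  intro z zb hz hzb
  refine ⟨?_, rfl⟩
  have hℓ : (0 : ℝ) ≤ ℓ := Nat.cast_nonneg ℓ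
  have hh : 0 ≤ (Δ + ℓ) / 2 := by linarith
  have hhb : 0 ≤ (Δ - ℓ) / 2 := by linarith
  have h0 : 0 ≤ |z| := abs_nonneg z
  have h0' : 0 ≤ |zb| := abs_nonneg zb
  have hA := summable_abs_chiralCoeff_mul_pow ((Δ + ℓ) / 2) h0 hz
  have hA' := summable_abs_chiralCoeff_mul_pow ((Δ + ℓ) / 2) h0' hzb
  have hB := summable_abs_chiralCoeff_mul_pow ((Δ - ℓ) / 2) h0 hz
  have hB' := summable_abs_chiralCoeff_mul_pow ((Δ - ℓ) / 2) h0' hzb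
  have hnnA : 0 ≤ fun m : ℕ => |chiralCoeff ((Δ + ℓ) / 2) m| * |z| ^ m := fun m => by positivity
  have hnnA' : 0 ≤ fun m : ℕ => |chiralCoeff ((Δ + ℓ) / 2) m| * |zb| ^ m := fun m => by positivity
  have hnnB : 0 ≤ fun m : ℕ => |chiralCoeff ((Δ - ℓ) / 2) m| * |z| ^ m := fun m => by positivity
  have hnnB' : 0 ≤ fun m : ℕ => |chiralCoeff ((Δ - ℓ) / 2) m| * |zb| ^ m := fun m => by positivity
  -- the two shifted product families
  have h1 : Summable fun p : ℕ × ℕ =>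
      (if ℓ ≤ p.1 then chiralCoeff ((Δ + ℓ) / 2) (p.1 - ℓ) * chiralCoeff ((Δ - ℓ) / 2) p.2 else 0) *
        |z| ^ p.1 * |zb| ^ p.2 := by
    refine summable_of_shift_fst ℓ (fun p hp => by simp [hp]) ?_
    refine ((hA.mul_of_nonneg hB' hnnA hnnB').mul_left (|z| ^ ℓ)).congr fun q => ?_
    have hq : ℓ ≤ q.1 + ℓ := Nat.le_add_left ℓ q.1
    simp only [if_pos hq, Nat.add_sub_cancel, pow_add, abs_chiralCoeff hh, abs_chiralCoeff hhb]
    ring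
  have h2 : Summable fun p : ℕ × ℕ =>
      (if ℓ ≤ p.2 then chiralCoeff ((Δ - ℓ) / 2) p.1 * chiralCoeff ((Δ + ℓ) / 2) (p.2 - ℓ) else 0) *
        |z| ^ p.1 * |zb| ^ p.2 := by
    refine summable_of_shift_snd ℓ (fun p hp => by simp [hp]) ?_
    refine ((hB.mul_of_nonneg hA' hnnB hnnA').mul_left (|zb| ^ ℓ)).congr fun q => ?_
    have hq : ℓ ≤ q.2 + ℓ := Nat.le_add_left ℓ q.2
    simp only [if_pos hq, Nat.add_sub_cancel, pow_add, abs_chiralCoeff hh, abs_chiralCoeff hhb]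
    ring
  refine (h1.add h2).congr fun p => ?_
  rw [abs_of_nonneg (gbCoeff_nonneg hΔ p), gbCoeff]
  ring

/-- **The 2D global block is of block shape.** For `ℓ ≤ Δ` and `(z, z̄)` in the open square,
`g_{Δ,ℓ}(z,z̄) = (z z̄)^{(Δ-ℓ)/2} K_{Δ,ℓ}(z,z̄)`: `k_{2h}(z) k_{2h̄}(z̄) = (z z̄)^{h̄} ∑ a_m(h) a_n(h̄) z^{ℓ+m} z̄^n`
and symmetrically (`h = h̄ + ℓ`). [cite: DolanOsborn2004, §3] -/
theorem globalBlock_eq_shape {Δ : ℝ} {ℓ : ℕ} (hΔ : (ℓ : ℝ) ≤ Δ) {z zb : ℝ} (hz : z ∈ Ioo (0 : ℝ) 1)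
    (hzb : zb ∈ Ioo (0 : ℝ) 1) :
    globalBlock Δ ℓ z zb = (z * zb) ^ ((Δ - ℓ) / 2) * gbSeries Δ ℓ z zb := by
  have hℓ : (0 : ℝ) ≤ ℓ := Nat.cast_nonneg ℓ
  have hh : 0 ≤ (Δ + ℓ) / 2 := by linarith
  have hhb : 0 ≤ (Δ - ℓ) / 2 := by linarith
  have hc : 0 < (z * zb) ^ ((Δ - ℓ) / 2) := Real.rpow_pos_of_pos (mul_pos hz.1 hzb.1) _
  have hcz : (z * zb) ^ ((Δ - ℓ) / 2) = z ^ ((Δ - ℓ) / 2) * zb ^ ((Δ - ℓ) / 2) :=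
    Real.mul_rpow hz.1.le hzb.1.le
  -- exponent bookkeeping: `h + m = h̄ + (m + ℓ)`
  have e1 : ∀ (x : ℝ), 0 < x → ∀ m : ℕ,
      x ^ ((Δ + ℓ) / 2 + (m : ℝ)) = x ^ ((Δ - ℓ) / 2) * x ^ (m + ℓ) := by
    intro x hx m
    rw [show (Δ + ℓ) / 2 + (m : ℝ) = (Δ - ℓ) / 2 + ((m + ℓ : ℕ) : ℝ) by push_cast; ring,
      Real.rpow_add hx, Real.rpow_natCast]
  have e2 : ∀ (x : ℝ), 0 < x → ∀ m : ℕ,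
      x ^ ((Δ - ℓ) / 2 + (m : ℝ)) = x ^ ((Δ - ℓ) / 2) * x ^ m := by
    intro x hx m
    rw [Real.rpow_add hx, Real.rpow_natCast]
  -- first product `k_{2h}(z) k_{2h̄}(z̄)`, reindexed by `(m, n) ↦ (m + ℓ, n)`
  have P1 : HasSum (fun p : ℕ × ℕ => (z * zb) ^ ((Δ - ℓ) / 2) *
      ((if ℓ ≤ p.1 then chiralCoeff ((Δ + ℓ) / 2) (p.1 - ℓ) * chiralCoeff ((Δ - ℓ) / 2) p.2 else 0) *
        z ^ p.1 * zb ^ p.2))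
      (chiralBlock ((Δ + ℓ) / 2) z * chiralBlock ((Δ - ℓ) / 2) zb) := by
    refine hasSum_of_shift_fst ℓ (fun p hp => by simp [hp]) ?_
    refine (hasSum_chiral_mul hh hhb hz hzb).congr_fun fun q => ?_
    have hq : ℓ ≤ q.1 + ℓ := Nat.le_add_left ℓ q.1
    simp only [if_pos hq, Nat.add_sub_cancel]
    rw [e1 z hz.1 q.1, e2 zb hzb.1 q.2, hcz]
    ring
  -- second product `k_{2h̄}(z) k_{2h}(z̄)`, reindexed by `(m, n) ↦ (m, n + ℓ)`
  have P2 : HasSum (fun p : ℕ × ℕ => (z * zb) ^ ((Δ - ℓ) / 2) *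
      ((if ℓ ≤ p.2 then chiralCoeff ((Δ - ℓ) / 2) p.1 * chiralCoeff ((Δ + ℓ) / 2) (p.2 - ℓ) else 0) *
        z ^ p.1 * zb ^ p.2))
      (chiralBlock ((Δ - ℓ) / 2) z * chiralBlock ((Δ + ℓ) / 2) zb) := by
    refine hasSum_of_shift_snd ℓ (fun p hp => by simp [hp]) ?_
    refine (hasSum_chiral_mul hhb hh hz hzb).congr_fun fun q => ?_
    have hq : ℓ ≤ q.2 + ℓ := Nat.le_add_left ℓ q.2
    simp only [if_pos hq, Nat.add_sub_cancel]
    rw [e2 z hz.1 q.1, e1 zb hzb.1 q.2, hcz]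
    ring
  have P : HasSum (fun p : ℕ × ℕ => (z * zb) ^ ((Δ - ℓ) / 2) *
      (gbCoeff Δ ℓ p * z ^ p.1 * zb ^ p.2)) (globalBlock Δ ℓ z zb) := by
    have hval : globalBlock Δ ℓ z zb = chiralBlock ((Δ + ℓ) / 2) z * chiralBlock ((Δ - ℓ) / 2) zb +
        chiralBlock ((Δ - ℓ) / 2) z * chiralBlock ((Δ + ℓ) / 2) zb := rfl
    rw [hval]
    refine (P1.add P2).congr_fun fun p => ?_
    simp only [gbCoeff]
    ring
  have P' := P.mul_left ((z * zb) ^ ((Δ - ℓ) / 2))⁻¹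
  have hfun : (fun p : ℕ × ℕ => ((z * zb) ^ ((Δ - ℓ) / 2))⁻¹ * ((z * zb) ^ ((Δ - ℓ) / 2) *
      (gbCoeff Δ ℓ p * z ^ p.1 * zb ^ p.2))) = fun p => gbCoeff Δ ℓ p * z ^ p.1 * zb ^ p.2 := by
    funext p
    rw [inv_mul_cancel_left₀ hc.ne']
  rw [hfun] at P'
  rw [gbSeries, P'.tsum_eq, mul_inv_cancel_left₀ hc.ne']

/-! ### The block on the diagonal -/

/-- **The block on the diagonal as a non-negative series**: for `ℓ ≤ Δ` and `0 < y < 1`,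
`g_{Δ,ℓ}(y,y) = ∑_{m,m'} a_m(h) a_{m'}(h̄) · 2 y^{Δ+m+m'}` (`HasSum`; from `hasSum_blockPair`, every pair
monomial on the diagonal being `2 y^{a+b}`). [cite: DolanOsborn2004, §3] -/
theorem hasSum_globalBlock_diag {Δ : ℝ} {ℓ : ℕ} (hΔ : (ℓ : ℝ) ≤ Δ) {y : ℝ} (hy : y ∈ Ioo (0 : ℝ) 1) :
    HasSum (fun mm : ℕ × ℕ => chiralCoeff ((Δ + ℓ) / 2) mm.1 * chiralCoeff ((Δ - ℓ) / 2) mm.2 *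
        (2 * y ^ (Δ + mm.1 + mm.2))) (globalBlock Δ ℓ y y) := by
  have hℓ : (0 : ℝ) ≤ ℓ := Nat.cast_nonneg ℓ
  have H := hasSum_blockPair (h := (Δ + ℓ) / 2) (hb := (Δ - ℓ) / 2) (by linarith) (by linarith) hy hy
  have hval : globalBlock Δ ℓ y y = chiralBlock ((Δ + ℓ) / 2) y * chiralBlock ((Δ - ℓ) / 2) y +
      chiralBlock ((Δ - ℓ) / 2) y * chiralBlock ((Δ + ℓ) / 2) y := rfl
  rw [hval]
  refine H.congr_fun fun mm => ?_
  have hpow : y ^ ((Δ + ℓ) / 2 + (mm.1 : ℝ)) * y ^ ((Δ - ℓ) / 2 + (mm.2 : ℝ)) =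
      y ^ (Δ + mm.1 + mm.2) := by
    rw [← Real.rpow_add hy.1]
    congr 1
    ring
  simp only [pairPow]
  rw [mul_comm (y ^ ((Δ - ℓ) / 2 + (mm.2 : ℝ))) (y ^ ((Δ + ℓ) / 2 + (mm.1 : ℝ))), hpow]
  ring

/-- `g_{Δ,ℓ}(y,y) ≥ 0` on the diagonal of the square (`ℓ ≤ Δ`). [folklore] -/
theorem globalBlock_diag_nonneg {Δ : ℝ} {ℓ : ℕ} (hΔ : (ℓ : ℝ) ≤ Δ) {y : ℝ} (hy : y ∈ Ioo (0 : ℝ) 1) :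
    0 ≤ globalBlock Δ ℓ y y := by
  have hℓ : (0 : ℝ) ≤ ℓ := Nat.cast_nonneg ℓ
  refine (hasSum_globalBlock_diag hΔ hy).nonneg fun mm => ?_
  have ha : 0 ≤ chiralCoeff ((Δ + ℓ) / 2) mm.1 * chiralCoeff ((Δ - ℓ) / 2) mm.2 :=
    mul_nonneg (chiralCoeff_nonneg (by linarith) _) (chiralCoeff_nonneg (by linarith) _)
  exact mul_nonneg ha (mul_nonneg (by norm_num) (Real.rpow_nonneg hy.1.le _))

/-- **Monotonicity on the diagonal**: `g_{Δ,ℓ}(y,y) ≤ g_{Δ,ℓ}(y',y')` for `0 < y ≤ y' < 1` (every term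
`2 a a y^{D}` with `D ≥ 0` is increasing in `y`). [folklore] -/
theorem globalBlock_diag_mono {Δ : ℝ} {ℓ : ℕ} (hΔ : (ℓ : ℝ) ≤ Δ) {y y' : ℝ} (hy : 0 < y)
    (hyy' : y ≤ y') (hy' : y' < 1) : globalBlock Δ ℓ y y ≤ globalBlock Δ ℓ y' y' := by
  have hℓ : (0 : ℝ) ≤ ℓ := Nat.cast_nonneg ℓ
  have hy1 : y < 1 := lt_of_le_of_lt hyy' hy'
  have hy'0 : 0 < y' := lt_of_lt_of_le hy hyy'
  refine hasSum_le (fun mm => ?_) (hasSum_globalBlock_diag hΔ ⟨hy, hy1⟩)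
    (hasSum_globalBlock_diag hΔ ⟨hy'0, hy'⟩)
  have ha : 0 ≤ chiralCoeff ((Δ + ℓ) / 2) mm.1 * chiralCoeff ((Δ - ℓ) / 2) mm.2 :=
    mul_nonneg (chiralCoeff_nonneg (by linarith) _) (chiralCoeff_nonneg (by linarith) _)
  have h1 : (0 : ℝ) ≤ mm.1 := Nat.cast_nonneg _
  have h2 : (0 : ℝ) ≤ mm.2 := Nat.cast_nonneg _
  have hD : 0 ≤ Δ + mm.1 + mm.2 := by linarith
  have hpow : y ^ (Δ + mm.1 + mm.2) ≤ y' ^ (Δ + mm.1 + mm.2) := Real.rpow_le_rpow hy.le hyy' hD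
  exact mul_le_mul_of_nonneg_left (by linarith) ha

/-- **The ratio bound on the diagonal**: for `0 < x ≤ 1/2`, `ℓ ≤ Δ` and `τ₀ ≤ Δ`,
`g_{Δ,ℓ}(x,x) ≤ (x/(1-x))^{τ₀} · g_{Δ,ℓ}(1-x,1-x)` — every monomial has total exponent
`D = Δ + m + m' ≥ τ₀` and `x^D = (x/(1-x))^D (1-x)^D ≤ (x/(1-x))^{τ₀} (1-x)^D` since `x/(1-x) ≤ 1`.
[folklore] -/
theorem globalBlock_diag_le_ratio {Δ τ₀ x : ℝ} {ℓ : ℕ} (hΔ : (ℓ : ℝ) ≤ Δ) (hτ : τ₀ ≤ Δ)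
    (hx0 : 0 < x) (hx2 : x ≤ 1 / 2) :
    globalBlock Δ ℓ x x ≤ (x / (1 - x)) ^ τ₀ * globalBlock Δ ℓ (1 - x) (1 - x) := by
  have hℓ : (0 : ℝ) ≤ ℓ := Nat.cast_nonneg ℓ
  have hx1 : x < 1 := by linarith
  have h1x0 : 0 < 1 - x := by linarith
  have h1x1 : 1 - x < 1 := by linarith
  have hb0 : 0 < x / (1 - x) := div_pos hx0 h1x0
  have hb1 : x / (1 - x) ≤ 1 := by rw [div_le_one h1x0]; linarith
  refine hasSum_le (fun mm => ?_) (hasSum_globalBlock_diag hΔ ⟨hx0, hx1⟩)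
    ((hasSum_globalBlock_diag hΔ ⟨h1x0, h1x1⟩).mul_left ((x / (1 - x)) ^ τ₀))
  have ha : 0 ≤ chiralCoeff ((Δ + ℓ) / 2) mm.1 * chiralCoeff ((Δ - ℓ) / 2) mm.2 :=
    mul_nonneg (chiralCoeff_nonneg (by linarith) _) (chiralCoeff_nonneg (by linarith) _)
  have h1 : (0 : ℝ) ≤ mm.1 := Nat.cast_nonneg _
  have h2 : (0 : ℝ) ≤ mm.2 := Nat.cast_nonneg _
  have hD : τ₀ ≤ Δ + mm.1 + mm.2 := by linarith
  have hxeq : x / (1 - x) * (1 - x) = x := by field_simp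
  have hpow : x ^ (Δ + mm.1 + mm.2) ≤ (x / (1 - x)) ^ τ₀ * (1 - x) ^ (Δ + mm.1 + mm.2) := by
    calc x ^ (Δ + mm.1 + mm.2) = (x / (1 - x) * (1 - x)) ^ (Δ + mm.1 + mm.2) := by rw [hxeq]
      _ = (x / (1 - x)) ^ (Δ + mm.1 + mm.2) * (1 - x) ^ (Δ + mm.1 + mm.2) :=
          Real.mul_rpow hb0.le h1x0.le
      _ ≤ (x / (1 - x)) ^ τ₀ * (1 - x) ^ (Δ + mm.1 + mm.2) :=
          mul_le_mul_of_nonneg_right (Real.rpow_le_rpow_of_exponent_ge hb0 hb1 hD)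
            (Real.rpow_nonneg h1x0.le _)
  calc chiralCoeff ((Δ + ℓ) / 2) mm.1 * chiralCoeff ((Δ - ℓ) / 2) mm.2 * (2 * x ^ (Δ + mm.1 + mm.2))
      ≤ chiralCoeff ((Δ + ℓ) / 2) mm.1 * chiralCoeff ((Δ - ℓ) / 2) mm.2 *
          (2 * ((x / (1 - x)) ^ τ₀ * (1 - x) ^ (Δ + mm.1 + mm.2))) :=
        mul_le_mul_of_nonneg_left (by linarith) ha
    _ = (x / (1 - x)) ^ τ₀ * (chiralCoeff ((Δ + ℓ) / 2) mm.1 * chiralCoeff ((Δ - ℓ) / 2) mm.2 *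
          (2 * (1 - x) ^ (Δ + mm.1 + mm.2))) := by ring

/-! ### The sign of a sum-rule term at a diagonal point `x < 1/2` -/

/-- The diagonal sign margin `c(s, τ₀, x) = ((1-x)(1-x))^s · ((x/(1-x))^{2s} - (x/(1-x))^{τ₀})`.
[folklore] -/
noncomputable def diagConst (s τ₀ x : ℝ) : ℝ :=
  ((1 - x) * (1 - x)) ^ s * ((x / (1 - x)) ^ (2 * s) - (x / (1 - x)) ^ τ₀)

/-- `c(s, τ₀, x) > 0` for `0 < x < 1/2` and `τ₀ > 2s` (`0 < x/(1-x) < 1`). [folklore] -/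
theorem diagConst_pos {s τ₀ x : ℝ} (hτ₀ : 2 * s < τ₀) (hx0 : 0 < x) (hx2 : x < 1 / 2) :
    0 < diagConst s τ₀ x := by
  have h1x0 : 0 < 1 - x := by linarith
  have hb0 : 0 < x / (1 - x) := div_pos hx0 h1x0
  have hb1 : x / (1 - x) < 1 := by rw [div_lt_one h1x0]; linarith
  unfold diagConst
  refine mul_pos (Real.rpow_pos_of_pos (mul_pos h1x0 h1x0) s) ?_
  have := Real.rpow_lt_rpow_of_exponent_gt hb0 hb1 hτ₀
  linarith

/-- **The sum-rule term at a diagonal point is dominated by the mirror block value**: for `ℓ ≤ Δ`,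
`τ₀ ≤ Δ` and `0 < x ≤ 1/2`,
`F^{s}_-[g_{Δ,ℓ}](x,x) = ((1-x)²)^s g(x,x) - (x²)^s g(1-x,1-x) ≤ -c(s,τ₀,x) · g_{Δ,ℓ}(1-x,1-x)`
(`(x²)^s = ((1-x)²)^s (x/(1-x))^{2s}` and the ratio bound). For `τ₀ > 2s`, `x < 1/2` the margin `c` is
positive, so every such term is `≤ 0` with a definite share of `g(1-x,1-x)`. [cite: RattazziEtAl2008, §3] -/
theorem crossF_globalBlock_diag_le {s Δ τ₀ x : ℝ} {ℓ : ℕ} (hΔ : (ℓ : ℝ) ≤ Δ) (hτ : τ₀ ≤ Δ)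
    (hx0 : 0 < x) (hx2 : x ≤ 1 / 2) :
    crossF s (-1) (globalBlock Δ ℓ) x x ≤ -(diagConst s τ₀ x) * globalBlock Δ ℓ (1 - x) (1 - x) := by
  have h1x0 : 0 < 1 - x := by linarith
  have hratio := globalBlock_diag_le_ratio hΔ hτ hx0 hx2
  have hg' : 0 ≤ globalBlock Δ ℓ (1 - x) (1 - x) := globalBlock_diag_nonneg hΔ ⟨h1x0, by linarith⟩
  have hv0 : 0 ≤ (1 - x) * (1 - x) := (mul_pos h1x0 h1x0).le
  have hv : 0 ≤ ((1 - x) * (1 - x)) ^ s := Real.rpow_nonneg hv0 s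
  have hb0 : 0 ≤ x / (1 - x) := (div_pos hx0 h1x0).le
  have hu : (x * x) ^ s = ((1 - x) * (1 - x)) ^ s * (x / (1 - x)) ^ (2 * s) := by
    rw [Real.rpow_mul hb0, Real.rpow_two, ← Real.mul_rpow hv0 (sq_nonneg _)]
    congr 1
    field_simp
  have hkey := mul_le_mul_of_nonneg_left hratio hv
  simp only [crossF]
  rw [hu, diagConst]
  nlinarith [hkey, hg', hv]

end Summit.CriticalPhenomena.Ising3D.Control2D
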